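import Mathlib.Analysis.SpecialFunctions.Pow.Real

/-!
# Crux `AdiabaticMultiKerrILED` (line `Sketch`) — quantitative lower bounds for the Morawetz bulk coefficients

Helper file for the crux `stmt-FinalStateConjecture-14310`
(`Summit.FinalStateConjecture.FinalStateConjecture.Theses.ClusterCompleteness.AdiabaticMultiKerrILED`),
line `Sketch`, stubs `morawetz_timeCoeff_lower`, `morawetz_angularCoeff_lower_outer`,
`morawetz_angularCoeff_lower_inner` (lead c7, wave 4c; quantitative companions of the sign facts of
`…MorawetzCoefficients`).

Setting (zero-spin tails-cut zone, static metric `g = −f dT² + dr²/f + r²dΩ²`,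
`f(s) = 1 − 2Mχ(s)/s`): the lead's degenerate Morawetz multiplier is `X = F ∂_{r*}`,
`F(s) = 1 − 3M/s`, with Lagrangian weight
`ϖ(s) = (1 − 2M/s)·((2s − 3M)/s² − M³(s − 3M)²/s⁶)`; the regrouped bulk is
`A_T ψ₀² + A_R (∂_{r*}ψ)² + A_ang |∇̸ψ|² + P ψ²`, `A_T = [f F_s + 2fF/s − ϖ]/(2f)`,
`A_ang = ½[−F f_s − f F_s + ϖ]`, `f_s = 2Mχ/s² − 2Mχ′/s`, with the value `χv ∈ [0, 1]` of `χ(s)`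
and the slope `χd ∈ [−1/(4M), 0]` of `χ′(s)` abstracted as real parameters. This file proves:

* `morawetz_timeCoeff_lower`: `A_T ≥ (s − 2M)M³(s − 3M)²/(2s⁷)` for `s > 2M`;
* `morawetz_angularCoeff_lower_outer`: `A_ang ≥ (s − 3M)²/(8s³)` for `s ≥ 8M`;
* `morawetz_angularCoeff_lower_inner`: on the Schwarzschild region (`χ = 1`, `χ′ = 0`),
  `A_ang ≥ (s − 3M)²/(8s³)` for `s > 2M`.

Proofs (Mathlib only, self-contained): write `RHS − LHS` as an explicit polynomial over a positive
denominator (`field_simp; ring`) and certify the sign of the polynomial as an explicit nonnegative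
combination of products of the hypothesis gaps (`nlinarith` fed the products, or `positivity`).
[folklore]
-/

noncomputable section

-- the doubled `FinalStateConjecture.FinalStateConjecture` path component trips dupNamespace
set_option linter.dupNamespace false

namespace Summit.FinalStateConjecture.FinalStateConjecture.Theorems

/-- `7s⁴ − 4M³s + 8M⁴ ≥ 0` for `0 < M`, `2M < s`: it equals
`(13/2)s⁴ + (1/2)s(s − 2M)(s² + 2Ms + 4M²) + 8M⁴`, a sum of nonnegative terms. [folklore] -/
private theorem morawetz_innerLowerPoly_nonneg {M s : ℝ} (hM : 0 < M) (hsM : 2 * M < s) :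
    0 ≤ 7 * s ^ 4 - 4 * M ^ 3 * s + 8 * M ^ 4 := by
  have hs : 0 < s := by linarith
  have h2 : 0 ≤ s - 2 * M := by linarith
  have hq : 0 ≤ s ^ 2 + 2 * M * s + 4 * M ^ 2 := by positivity
  nlinarith [pow_nonneg hs.le 4, mul_nonneg (mul_nonneg hs.le h2) hq, pow_nonneg hM.le 4]

/-- `(5s − 21M)s⁴ − 4(s − 2M)M³(s − 3M) ≥ 0` for `0 < M`, `8M ≤ s`: it equals
`5(s − 8M)s⁴ + 19Ms²(s − 8M)(s + 8M) + 1212M³s² + 4M⁴(5s − 6M)`, a sum of nonnegative terms.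
[folklore] -/
private theorem morawetz_outerLowerPoly_nonneg {M s : ℝ} (hM : 0 < M) (hsM : 8 * M ≤ s) :
    0 ≤ (5 * s - 21 * M) * s ^ 4 - 4 * (s - 2 * M) * M ^ 3 * (s - 3 * M) := by
  have hs : 0 < s := by linarith
  have h8 : 0 ≤ s - 8 * M := by linarith
  have h8' : 0 ≤ s + 8 * M := by linarith
  have h56 : 0 ≤ 5 * s - 6 * M := by linarith
  nlinarith [mul_nonneg h8 (pow_nonneg hs.le 4),
    mul_nonneg (mul_nonneg (mul_nonneg hM.le (sq_nonneg s)) h8) h8',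
    mul_nonneg (pow_nonneg hM.le 3) (sq_nonneg s), mul_nonneg (pow_nonneg hM.le 4) h56]

/-- **Stub `morawetz_timeCoeff_lower`** (crux `AdiabaticMultiKerrILED`, line `Sketch`). Quantitative
form of `morawetz_timeCoeff_nonneg`: the time coefficient `A_T = [f F_s + 2fF/s − ϖ]/(2f)`
(`F = 1 − 3M/s`, `f = 1 − 2Mχv/s`, `ϖ(s) = (1 − 2M/s)((2s − 3M)/s² − M³(s − 3M)²/s⁶)`) satisfies
`A_T ≥ (s − 2M)M³(s − 3M)²/(2s⁷)` for `s > 2M`, `χv ∈ [0, 1]`: indeed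
`A_T − (s − 2M)M³(s − 3M)²/(2s⁷) = [M(1 − χv)(2s − 3M)s⁵ + Mχv(s − 2M)M³(s − 3M)²]/((s − 2Mχv)s⁷)`,
all factors nonnegative. [folklore] -/
theorem morawetz_timeCoeff_lower : ∀ (M s χv : ℝ), 0 < M → 2 * M < s → 0 ≤ χv → χv ≤ 1 → (s - 2 * M) * M ^ 3 * (s - 3 * M) ^ 2 / (2 * s ^ 7) ≤ ((1 - 2 * M * χv / s) * (3 * M / s ^ 2) + 2 * (1 - 2 * M * χv / s) * (1 - 3 * M / s) / s - (fun s : ℝ ↦ (1 - 2 * M / s) * ((2 * s - 3 * M) / s ^ 2 - M ^ 3 * (s - 3 * M) ^ 2 / s ^ 6)) s) / (2 * (1 - 2 * M * χv / s)) := by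
  intro M s χv hM hsM hχ0 hχ1
  beta_reduce
  have hs : 0 < s := by linarith
  have hχs : 2 * M * χv < s := by nlinarith [mul_le_mul_of_nonneg_left hχ1 hM.le]
  have hden : 0 < s - 2 * M * χv := by linarith
  have hden' : s - 2 * M * χv ≠ 0 := hden.ne'
  have hf : 0 < 1 - 2 * M * χv / s := by
    rw [sub_pos, div_lt_one hs]
    exact hχs
  have hf' : 1 - 2 * M * χv / s ≠ 0 := hf.ne'
  rw [← sub_nonneg]
  have key : ((1 - 2 * M * χv / s) * (3 * M / s ^ 2) +
      2 * (1 - 2 * M * χv / s) * (1 - 3 * M / s) / s -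
      (1 - 2 * M / s) * ((2 * s - 3 * M) / s ^ 2 - M ^ 3 * (s - 3 * M) ^ 2 / s ^ 6)) /
      (2 * (1 - 2 * M * χv / s)) - (s - 2 * M) * M ^ 3 * (s - 3 * M) ^ 2 / (2 * s ^ 7) =
      (M * (1 - χv) * (2 * s - 3 * M) * s ^ 5 + M * χv * (s - 2 * M) * M ^ 3 * (s - 3 * M) ^ 2) /
        ((s - 2 * M * χv) * s ^ 7) := by
    field_simp
    ring
  rw [key]
  have h1 : 0 ≤ 1 - χv := by linarith
  have h2 : 0 ≤ 2 * s - 3 * M := by linarith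
  have h3 : 0 ≤ s - 2 * M := by linarith
  positivity

/-- **Stub `morawetz_angularCoeff_lower_outer`** (crux `AdiabaticMultiKerrILED`, line `Sketch`).
Quantitative form of `morawetz_angularCoeff_nonneg_outer`: the angular coefficient
`A_ang = ½[−F f_s − f F_s + ϖ]` (`F = 1 − 3M/s`, `f = 1 − 2Mχv/s`, `f_s = 2Mχv/s² − 2Mχd/s`)
satisfies `A_ang ≥ (s − 3M)²/(8s³)` for `s ≥ 8M`, `χv ∈ [0, 1]`, `χd ∈ [−1/(4M), 0]`:
`8s⁷·(A_ang − (s − 3M)²/(8s³))` equals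
`(s − 3M)·[(5s − 21M)s⁴ − 4(s − 2M)M³(s − 3M)] + 8Ms⁴(s − 6M)(1 − χv) + 2s⁵(s − 3M)(4Mχd + 1)`,
each summand nonnegative (the bracket by `morawetz_outerLowerPoly_nonneg`). [folklore] -/
theorem morawetz_angularCoeff_lower_outer : ∀ (M s χv χd : ℝ), 0 < M → 8 * M ≤ s → 0 ≤ χv → χv ≤ 1 → -(1 / (4 * M)) ≤ χd → χd ≤ 0 → (s - 3 * M) ^ 2 / (8 * s ^ 3) ≤ 2⁻¹ * (-(1 - 3 * M / s) * (2 * M * χv / s ^ 2 - 2 * M * χd / s) - (1 - 2 * M * χv / s) * (3 * M / s ^ 2) + (fun s : ℝ ↦ (1 - 2 * M / s) * ((2 * s - 3 * M) / s ^ 2 - M ^ 3 * (s - 3 * M) ^ 2 / s ^ 6)) s) := by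
  intro M s χv χd hM hsM _hχ0 hχ1 hd0 _hd1
  beta_reduce
  have hs : 0 < s := by linarith
  have hd : 0 ≤ 4 * M * χd + 1 := by
    have h4M : (0 : ℝ) < 4 * M := by positivity
    rw [neg_le, le_div_iff₀ h4M] at hd0
    linarith
  have h3 : 0 ≤ s - 3 * M := by linarith
  have h6 : 0 ≤ s - 6 * M := by linarith
  have h1 : 0 ≤ 1 - χv := by linarith
  have hT : 0 ≤ (s - 3 * M) * ((5 * s - 21 * M) * s ^ 4 - 4 * (s - 2 * M) * M ^ 3 * (s - 3 * M)) +
      8 * M * s ^ 4 * (s - 6 * M) * (1 - χv) + 2 * s ^ 5 * (s - 3 * M) * (4 * M * χd + 1) := by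
    nlinarith [mul_nonneg h3 (morawetz_outerLowerPoly_nonneg hM hsM),
      mul_nonneg (mul_nonneg (mul_nonneg hM.le (pow_nonneg hs.le 4)) h6) h1,
      mul_nonneg (mul_nonneg (pow_nonneg hs.le 5) h3) hd]
  rw [← sub_nonneg]
  have key : 2⁻¹ * (-(1 - 3 * M / s) * (2 * M * χv / s ^ 2 - 2 * M * χd / s) -
      (1 - 2 * M * χv / s) * (3 * M / s ^ 2) +
      (1 - 2 * M / s) * ((2 * s - 3 * M) / s ^ 2 - M ^ 3 * (s - 3 * M) ^ 2 / s ^ 6)) -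
      (s - 3 * M) ^ 2 / (8 * s ^ 3) =
      ((s - 3 * M) * ((5 * s - 21 * M) * s ^ 4 - 4 * (s - 2 * M) * M ^ 3 * (s - 3 * M)) +
        8 * M * s ^ 4 * (s - 6 * M) * (1 - χv) + 2 * s ^ 5 * (s - 3 * M) * (4 * M * χd + 1)) /
        (8 * s ^ 7) := by
    field_simp
    ring
  rw [key]
  positivity

/-- **Stub `morawetz_angularCoeff_lower_inner`** (crux `AdiabaticMultiKerrILED`, line `Sketch`).
On the Schwarzschild region (`χ = 1`, `χ′ = 0`) the angular coefficient
`A_ang = ½[−F f_s − f F_s + ϖ] = (s − 3M)²(2s⁴ − M³s + 2M⁴)/(2s⁷)` satisfies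
`A_ang ≥ (s − 3M)²/(8s³)` for `s > 2M`:
`A_ang − (s − 3M)²/(8s³) = (s − 3M)²(7s⁴ − 4M³s + 8M⁴)/(8s⁷)` and `7s⁴ − 4M³s + 8M⁴ ≥ 0`
(`morawetz_innerLowerPoly_nonneg`). [folklore] -/
theorem morawetz_angularCoeff_lower_inner : ∀ (M s : ℝ), 0 < M → 2 * M < s → (s - 3 * M) ^ 2 / (8 * s ^ 3) ≤ 2⁻¹ * (-(1 - 3 * M / s) * (2 * M / s ^ 2) - (1 - 2 * M / s) * (3 * M / s ^ 2) + (fun s : ℝ ↦ (1 - 2 * M / s) * ((2 * s - 3 * M) / s ^ 2 - M ^ 3 * (s - 3 * M) ^ 2 / s ^ 6)) s) := by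
  intro M s hM hsM
  beta_reduce
  have hs : 0 < s := by linarith
  rw [← sub_nonneg]
  have key : 2⁻¹ * (-(1 - 3 * M / s) * (2 * M / s ^ 2) - (1 - 2 * M / s) * (3 * M / s ^ 2) +
      (1 - 2 * M / s) * ((2 * s - 3 * M) / s ^ 2 - M ^ 3 * (s - 3 * M) ^ 2 / s ^ 6)) -
      (s - 3 * M) ^ 2 / (8 * s ^ 3) =
      (s - 3 * M) ^ 2 * (7 * s ^ 4 - 4 * M ^ 3 * s + 8 * M ^ 4) / (8 * s ^ 7) := by
    field_simp
    ring
  rw [key]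
  have hP := morawetz_innerLowerPoly_nonneg hM hsM
  positivity

end Summit.FinalStateConjecture.FinalStateConjecture.Theorems

end
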